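import Mathlib
import HarnessLib
import Summits.ValiantsHypothesis.ValiantsHypothesis.Theorems.LacunarySymmetroidMatrixDescartesProductPlusOneRowTowerKMasterLaw

/-!
# LINE (A) `product_plus_one` — the SWITCHED MASTER LAW «pole cluster on top, knees anywhere ≥ p below it» (every support size, switched side)

Mirror companion of ✓ `…RowTowerKMasterLaw`.  There the row is unswitched (`u > 0`): the positive-weight letters are the knees (bottom cluster, width
`≤ p`) and the poles may sit anywhere `≥ p` above.  Here the row is SWITCHED (`A − Σ B_l x^{λ_l} < 0`, i.e. the window lies beyond the root): the
positive-weight letters are now the TOP cluster (tail letters with `B_l > 0`, rates in `[σ, σ + p]`) and the negative-weight letters — the bottom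
letter (rate `0`, needs `σ ≥ p` when `A ≠ 0`) and the tail letters with `B_l < 0` (rates `≤ σ − p`) — may sit ANYWHERE at least `p` below the cluster:
★ `rowPsiK3_master_law_switched`: `p²ψ₁ + 6ψ₁² ≤ ψ₃`, indeed `ψ₃ − p²ψ₁ − 6ψ₁² ≥ Σ_{B_l<0} w_l φ_p(σ − λ_l) ≥ 0` (`rowPsiK3_master_ge_switched`), strict
from a far letter (`rowPsiK3_gt_of_master_switched_far`: some `B_l < 0` with `λ_l + p < σ`; `…_far0`: `A ≠ 0` with `p < σ`) or from `ψ₁ ≠ 0`.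
Same two scalar tools (✓ `phi_antitone`, ✓ `phi_sub_ge`); the bottom atom is now one of the negative letters.

Honest framing: calculus of rows (helpers); nothing closes a stub; `OneChangeFloorK3` / `WronskianBudgetK3` / 18050 / `MatrixDescartes` OPEN; `VP ≠ VNP` NOT proved.
No definitions, no named facts.
-/

set_option linter.dupNamespace false

namespace Summit.ValiantsHypothesis.ValiantsHypothesis.Theorems.LacunarySymmetroidMatrixDescartes

namespace ProductPlusOne

open Finset
open scoped BigOperators

variable {n : ℕ} (lam : Fin n → ℕ) (A : ℝ) (B : Fin n → ℝ)

/-- `u < 0` for a switched row. [this file's lemma] -/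
theorem rowUK_lt_zero {x : ℝ} (hF : A - ∑ l, B l * x ^ (lam l) < 0) : rowUK lam A B x < 0 := by
  unfold rowUK; exact inv_lt_zero.2 hF

/-- The switched pair bound: with `g_l = w_l φ_p(σ − λ_l)` on the low letters (`B_l < 0`) and `0` elsewhere, every term of the pair double sum is
`≥ w_l g_{l'} + g_l w_{l'}` (top cluster in `[σ, σ + p]`, low letters `≤ σ − p`, `u < 0`). [this file's lemma] -/
theorem masterPair_ge_switched (p σ : ℕ) {x : ℝ} (hx : 0 < x) (hF : A - ∑ l, B l * x ^ (lam l) < 0)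
    (hhigh : ∀ l, 0 < B l → σ ≤ lam l ∧ lam l ≤ σ + p) (hlow : ∀ l, B l < 0 → lam l + p ≤ σ) (l l' : Fin n) :
    (-(B l * x ^ (lam l))) * rowUK lam A B x * (if B l' < 0 then (-(B l' * x ^ (lam l'))) * rowUK lam A B x * (((σ : ℝ) - ((lam l' : ℕ) : ℝ)) ^ 2 * ((p : ℝ) ^ 2 - ((σ : ℝ) - ((lam l' : ℕ) : ℝ)) ^ 2)) else 0)
      + (if B l < 0 then (-(B l * x ^ (lam l))) * rowUK lam A B x * (((σ : ℝ) - ((lam l : ℕ) : ℝ)) ^ 2 * ((p : ℝ) ^ 2 - ((σ : ℝ) - ((lam l : ℕ) : ℝ)) ^ 2)) else 0) * ((-(B l' * x ^ (lam l'))) * rowUK lam A B x)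
    ≤ (-(B l * x ^ (lam l))) * rowUK lam A B x * ((-(B l' * x ^ (lam l'))) * rowUK lam A B x) * ((((lam l : ℕ) : ℝ) - ((lam l' : ℕ) : ℝ)) ^ 2 * ((p : ℝ) ^ 2 - (((lam l : ℕ) : ℝ) - ((lam l' : ℕ) : ℝ)) ^ 2)) := by
  have hu := rowUK_lt_zero lam A B hF
  have hp0 : (0 : ℝ) ≤ (p : ℝ) := Nat.cast_nonneg p
  have hwneg : ∀ i, B i < 0 → (-(B i * x ^ (lam i))) * rowUK lam A B x ≤ 0 := fun i hi => by
    have : 0 < -(B i * x ^ (lam i)) := by have := mul_neg_of_neg_of_pos hi (pow_pos hx (lam i)); linarith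
    exact mul_nonpos_of_nonneg_of_nonpos this.le hu.le
  have hwpos : ∀ i, 0 < B i → 0 ≤ (-(B i * x ^ (lam i))) * rowUK lam A B x := fun i hi => by
    have : -(B i * x ^ (lam i)) ≤ 0 := by have := mul_pos hi (pow_pos hx (lam i)); linarith
    exact mul_nonneg_of_nonpos_of_nonpos this hu.le
  set w : Fin n → ℝ := fun i => (-(B i * x ^ (lam i))) * rowUK lam A B x with hw
  set R : Fin n → ℝ := fun i => ((lam i : ℕ) : ℝ) with hR
  show w l * (if B l' < 0 then w l' * (((σ : ℝ) - R l') ^ 2 * ((p : ℝ) ^ 2 - ((σ : ℝ) - R l') ^ 2)) else 0)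
      + (if B l < 0 then w l * (((σ : ℝ) - R l) ^ 2 * ((p : ℝ) ^ 2 - ((σ : ℝ) - R l) ^ 2)) else 0) * w l'
    ≤ w l * w l' * ((R l - R l') ^ 2 * ((p : ℝ) ^ 2 - (R l - R l') ^ 2))
  rcases lt_trichotomy (B l) 0 with hl | hl | hl <;> rcases lt_trichotomy (B l') 0 with hl' | hl' | hl'
  · -- low, low: superadditivity
    rw [if_pos hl, if_pos hl']
    have ha : R l + p ≤ (σ : ℝ) := by simp only [hR]; exact_mod_cast hlow l hl
    have hb : R l' + p ≤ (σ : ℝ) := by simp only [hR]; exact_mod_cast hlow l' hl'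
    have hsub := phi_sub_ge hp0 (by linarith : (p : ℝ) ≤ (σ : ℝ) - R l') (by linarith : (p : ℝ) ≤ (σ : ℝ) - R l)
    have hev : ((σ : ℝ) - R l' - ((σ : ℝ) - R l)) = R l - R l' := by ring
    rw [hev] at hsub
    have hww : 0 ≤ w l * w l' := mul_nonneg_of_nonpos_of_nonpos (hwneg l hl) (hwneg l' hl')
    have := mul_le_mul_of_nonneg_left hsub hww
    linarith
  · have hw0 : w l' = 0 := by simp [hw, hl']
    simp [hw0, hl']
  · -- low `l`, high `l'`
    rw [if_neg (not_lt.2 hl'.le), if_pos hl, mul_zero, zero_add]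
    have ha : R l + p ≤ (σ : ℝ) := by simp only [hR]; exact_mod_cast hlow l hl
    have hb : (σ : ℝ) ≤ R l' := by simp only [hR]; exact_mod_cast (hhigh l' hl').1
    have hanti := phi_antitone hp0 (by linarith : (p : ℝ) ≤ (σ : ℝ) - R l) (by linarith : (σ : ℝ) - R l ≤ R l' - R l)
    have hev : (R l - R l') ^ 2 = (R l' - R l) ^ 2 := by ring
    rw [hev]
    have hww : w l * w l' ≤ 0 := mul_nonpos_of_nonpos_of_nonneg (hwneg l hl) (hwpos l' hl')
    have := mul_le_mul_of_nonpos_left hanti hww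
    linarith
  · have hw0 : w l = 0 := by simp [hw, hl]
    simp [hw0, hl]
  · have hw0 : w l = 0 := by simp [hw, hl]
    simp [hw0, hl]
  · have hw0 : w l = 0 := by simp [hw, hl]
    simp [hw0, hl]
  · -- high `l`, low `l'`
    rw [if_pos hl', if_neg (not_lt.2 hl.le), zero_mul, add_zero]
    have ha : R l' + p ≤ (σ : ℝ) := by simp only [hR]; exact_mod_cast hlow l' hl'
    have hb : (σ : ℝ) ≤ R l := by simp only [hR]; exact_mod_cast (hhigh l hl).1
    have hanti := phi_antitone hp0 (by linarith : (p : ℝ) ≤ (σ : ℝ) - R l') (by linarith : (σ : ℝ) - R l' ≤ R l - R l')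
    have hww : w l * w l' ≤ 0 := mul_nonpos_of_nonneg_of_nonpos (hwpos l hl) (hwneg l' hl')
    have := mul_le_mul_of_nonpos_left hanti hww
    linarith
  · have hw0 : w l' = 0 := by simp [hw, hl']
    simp [hw0, hl']
  · -- high, high: gap `≤ p`
    rw [if_neg (not_lt.2 hl.le), if_neg (not_lt.2 hl'.le), mul_zero, zero_mul, add_zero]
    obtain ⟨h1, h2⟩ := hhigh l hl
    obtain ⟨h1', h2'⟩ := hhigh l' hl'
    have ha : (σ : ℝ) ≤ R l := by simp only [hR]; exact_mod_cast h1
    have hb : R l ≤ (σ : ℝ) + p := by simp only [hR]; exact_mod_cast h2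
    have ha' : (σ : ℝ) ≤ R l' := by simp only [hR]; exact_mod_cast h1'
    have hb' : R l' ≤ (σ : ℝ) + p := by simp only [hR]; exact_mod_cast h2'
    have hgap : (R l - R l') ^ 2 ≤ (p : ℝ) ^ 2 := sq_le_sq' (by linarith) (by linarith)
    exact mul_nonneg (mul_nonneg (hwpos l hl) (hwpos l' hl')) (mul_nonneg (sq_nonneg _) (by linarith))

/-- The switched bottom bound: `A u · w_l φ_p(λ_l) ≥ w_l·g₀ + A u·g_l` with `g₀ := A u φ_p(σ)` (`A ≥ 0`; `σ ≥ p` when `A ≠ 0`). [this file's lemma] -/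
theorem masterBottom_ge_switched (p σ : ℕ) {x : ℝ} (hx : 0 < x) (hF : A - ∑ l, B l * x ^ (lam l) < 0) (hA : 0 ≤ A) (h0 : A ≠ 0 → p ≤ σ)
    (hhigh : ∀ l, 0 < B l → σ ≤ lam l ∧ lam l ≤ σ + p) (hlow : ∀ l, B l < 0 → lam l + p ≤ σ) (l : Fin n) :
    (-(B l * x ^ (lam l))) * rowUK lam A B x * (A * rowUK lam A B x * (((σ : ℝ)) ^ 2 * ((p : ℝ) ^ 2 - ((σ : ℝ)) ^ 2))) + A * rowUK lam A B x * (if B l < 0 then (-(B l * x ^ (lam l))) * rowUK lam A B x * (((σ : ℝ) - ((lam l : ℕ) : ℝ)) ^ 2 * ((p : ℝ) ^ 2 - ((σ : ℝ) - ((lam l : ℕ) : ℝ)) ^ 2)) else 0)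
    ≤ A * rowUK lam A B x * ((-(B l * x ^ (lam l))) * rowUK lam A B x * (((lam l : ℕ) : ℝ) ^ 2 * ((p : ℝ) ^ 2 - ((lam l : ℕ) : ℝ) ^ 2))) := by
  have hu := rowUK_lt_zero lam A B hF
  have hp0 : (0 : ℝ) ≤ (p : ℝ) := Nat.cast_nonneg p
  rcases eq_or_ne A 0 with hA0 | hA0
  · rw [hA0]; simp
  have hσp : (p : ℝ) ≤ (σ : ℝ) := by exact_mod_cast h0 hA0
  have hAu : A * rowUK lam A B x ≤ 0 := mul_nonpos_of_nonneg_of_nonpos hA hu.le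
  have hl0 : (0 : ℝ) ≤ ((lam l : ℕ) : ℝ) := Nat.cast_nonneg _
  rcases lt_trichotomy (B l) 0 with hl | hl | hl
  · -- low letter: superadditivity with `a = σ`, `b = σ − λ_l`
    rw [if_pos hl]
    have ha : ((lam l : ℕ) : ℝ) + p ≤ (σ : ℝ) := by exact_mod_cast hlow l hl
    have hsub := phi_sub_ge hp0 (le_refl _ |>.trans hσp) (by linarith : (p : ℝ) ≤ (σ : ℝ) - ((lam l : ℕ) : ℝ))
    have hev : ((σ : ℝ) - ((σ : ℝ) - ((lam l : ℕ) : ℝ))) = ((lam l : ℕ) : ℝ) := by ring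
    rw [hev] at hsub
    have hw : (-(B l * x ^ (lam l))) * rowUK lam A B x ≤ 0 := by
      have : 0 < -(B l * x ^ (lam l)) := by have := mul_neg_of_neg_of_pos hl (pow_pos hx (lam l)); linarith
      exact mul_nonpos_of_nonneg_of_nonpos this.le hu.le
    have hww : 0 ≤ A * rowUK lam A B x * ((-(B l * x ^ (lam l))) * rowUK lam A B x) := mul_nonneg_of_nonpos_of_nonpos hAu hw
    have := mul_le_mul_of_nonneg_left hsub hww
    linarith
  · rw [hl]; simp
  · -- high letter: antitonicity from `σ` to `λ_l`
    rw [if_neg (not_lt.2 hl.le), mul_zero, add_zero]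
    have hb : (σ : ℝ) ≤ ((lam l : ℕ) : ℝ) := by exact_mod_cast (hhigh l hl).1
    have hanti := phi_antitone hp0 hσp hb
    have hw : 0 ≤ (-(B l * x ^ (lam l))) * rowUK lam A B x := by
      have : -(B l * x ^ (lam l)) ≤ 0 := by have := mul_pos hl (pow_pos hx (lam l)); linarith
      exact mul_nonneg_of_nonpos_of_nonpos this hu.le
    have hww : A * rowUK lam A B x * ((-(B l * x ^ (lam l))) * rowUK lam A B x) ≤ 0 := mul_nonpos_of_nonpos_of_nonneg hAu hw
    have := mul_le_mul_of_nonpos_left hanti hww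
    linarith

/-- The bottom letter's own contribution is non-negative: `(Σ_l w_l)·(A u φ_p(σ)) = (1 − A u)·A u φ_p(σ) ≥ 0` (`u < 0`, `A ≥ 0`, `σ ≥ p` if `A ≠ 0`).
[this file's lemma] -/
theorem masterBottom_self_nonneg_switched (p σ : ℕ) {x : ℝ} (hF : A - ∑ l, B l * x ^ (lam l) < 0) (hA : 0 ≤ A) (h0 : A ≠ 0 → p ≤ σ) :
    0 ≤ (∑ l, (-(B l * x ^ (lam l))) * rowUK lam A B x) * (A * rowUK lam A B x * (((σ : ℝ)) ^ 2 * ((p : ℝ) ^ 2 - ((σ : ℝ)) ^ 2))) := by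
  have hu := rowUK_lt_zero lam A B hF
  have h1 : A * rowUK lam A B x + ∑ l, (-(B l * x ^ (lam l))) * rowUK lam A B x = 1 := rateWeights_sum_eq_one lam A B hF.ne
  have hT : ∑ l, (-(B l * x ^ (lam l))) * rowUK lam A B x = 1 - A * rowUK lam A B x := by linarith
  rw [hT]
  have hAu : A * rowUK lam A B x ≤ 0 := mul_nonpos_of_nonneg_of_nonpos hA hu.le
  rcases eq_or_ne A 0 with hA0 | hA0
  · rw [hA0]; simp
  · have hσp : (p : ℝ) ≤ (σ : ℝ) := by exact_mod_cast h0 hA0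
    have hp0 : (0 : ℝ) ≤ (p : ℝ) := Nat.cast_nonneg p
    have hφ : ((σ : ℝ)) ^ 2 * ((p : ℝ) ^ 2 - ((σ : ℝ)) ^ 2) ≤ 0 := mul_nonpos_of_nonneg_of_nonpos (sq_nonneg _) (by nlinarith)
    have : 0 ≤ A * rowUK lam A B x * (((σ : ℝ)) ^ 2 * ((p : ℝ) ^ 2 - ((σ : ℝ)) ^ 2)) := mul_nonneg_of_nonpos_of_nonpos hAu hφ
    exact mul_nonneg (by linarith) this

/-- ★ **THE SWITCHED MASTER LAW, quantitative form**: `ψ₃ − p²ψ₁ − 6ψ₁² ≥ Σ_{B_l < 0} w_l φ_p(σ − λ_l) + (Σ_l w_l)·A u φ_p(σ)` (every summand `≥ 0`).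
[this file's theorem] -/
theorem rowPsiK3_master_ge_switched (p σ : ℕ) {x : ℝ} (hx : 0 < x) (hF : A - ∑ l, B l * x ^ (lam l) < 0) (hA : 0 ≤ A) (h0 : A ≠ 0 → p ≤ σ)
    (hhigh : ∀ l, 0 < B l → σ ≤ lam l ∧ lam l ≤ σ + p) (hlow : ∀ l, B l < 0 → lam l + p ≤ σ) :
    ∑ l, (if B l < 0 then (-(B l * x ^ (lam l))) * rowUK lam A B x * (((σ : ℝ) - ((lam l : ℕ) : ℝ)) ^ 2 * ((p : ℝ) ^ 2 - ((σ : ℝ) - ((lam l : ℕ) : ℝ)) ^ 2)) else 0) + (∑ l, (-(B l * x ^ (lam l))) * rowUK lam A B x) * (A * rowUK lam A B x * (((σ : ℝ)) ^ 2 * ((p : ℝ) ^ 2 - ((σ : ℝ)) ^ 2)))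
      ≤ rowPsiK3 lam A B x - (p : ℝ) ^ 2 * rowPsiK1 lam A B x - 6 * rowPsiK1 lam A B x ^ 2 := by
  rw [rowPsiK3_pair_certificate lam A B (p : ℝ) hF.ne]
  have h1 : A * rowUK lam A B x + ∑ l, (-(B l * x ^ (lam l))) * rowUK lam A B x = 1 := rateWeights_sum_eq_one lam A B hF.ne
  have hpair : ∑ l, ∑ l', ((-(B l * x ^ (lam l))) * rowUK lam A B x * (if B l' < 0 then (-(B l' * x ^ (lam l'))) * rowUK lam A B x * (((σ : ℝ) - ((lam l' : ℕ) : ℝ)) ^ 2 * ((p : ℝ) ^ 2 - ((σ : ℝ) - ((lam l' : ℕ) : ℝ)) ^ 2)) else 0) + (if B l < 0 then (-(B l * x ^ (lam l))) * rowUK lam A B x * (((σ : ℝ) - ((lam l : ℕ) : ℝ)) ^ 2 * ((p : ℝ) ^ 2 - ((σ : ℝ) - ((lam l : ℕ) : ℝ)) ^ 2)) else 0) * ((-(B l' * x ^ (lam l'))) * rowUK lam A B x))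
      ≤ ∑ l, ∑ l', (-(B l * x ^ (lam l))) * rowUK lam A B x * ((-(B l' * x ^ (lam l'))) * rowUK lam A B x) * ((((lam l : ℕ) : ℝ) - ((lam l' : ℕ) : ℝ)) ^ 2 * ((p : ℝ) ^ 2 - (((lam l : ℕ) : ℝ) - ((lam l' : ℕ) : ℝ)) ^ 2)) :=
    Finset.sum_le_sum fun l _ => Finset.sum_le_sum fun l' _ => masterPair_ge_switched lam A B p σ hx hF hhigh hlow l l'
  have hdouble : ∑ l, ∑ l', ((-(B l * x ^ (lam l))) * rowUK lam A B x * (if B l' < 0 then (-(B l' * x ^ (lam l'))) * rowUK lam A B x * (((σ : ℝ) - ((lam l' : ℕ) : ℝ)) ^ 2 * ((p : ℝ) ^ 2 - ((σ : ℝ) - ((lam l' : ℕ) : ℝ)) ^ 2)) else 0) + (if B l < 0 then (-(B l * x ^ (lam l))) * rowUK lam A B x * (((σ : ℝ) - ((lam l : ℕ) : ℝ)) ^ 2 * ((p : ℝ) ^ 2 - ((σ : ℝ) - ((lam l : ℕ) : ℝ)) ^ 2)) else 0) * ((-(B l' * x ^ (lam l'))) * rowUK lam A B x))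
      = 2 * ((∑ l, (-(B l * x ^ (lam l))) * rowUK lam A B x) * ∑ l, (if B l < 0 then (-(B l * x ^ (lam l))) * rowUK lam A B x * (((σ : ℝ) - ((lam l : ℕ) : ℝ)) ^ 2 * ((p : ℝ) ^ 2 - ((σ : ℝ) - ((lam l : ℕ) : ℝ)) ^ 2)) else 0)) := by
    simp only [Finset.sum_add_distrib, ← Finset.mul_sum, ← Finset.sum_mul]
    ring
  have hbottom : ∑ l, ((-(B l * x ^ (lam l))) * rowUK lam A B x * (A * rowUK lam A B x * (((σ : ℝ)) ^ 2 * ((p : ℝ) ^ 2 - ((σ : ℝ)) ^ 2))) + A * rowUK lam A B x * (if B l < 0 then (-(B l * x ^ (lam l))) * rowUK lam A B x * (((σ : ℝ) - ((lam l : ℕ) : ℝ)) ^ 2 * ((p : ℝ) ^ 2 - ((σ : ℝ) - ((lam l : ℕ) : ℝ)) ^ 2)) else 0))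
      ≤ ∑ l, A * rowUK lam A B x * ((-(B l * x ^ (lam l))) * rowUK lam A B x * (((lam l : ℕ) : ℝ) ^ 2 * ((p : ℝ) ^ 2 - ((lam l : ℕ) : ℝ) ^ 2))) :=
    Finset.sum_le_sum fun l _ => masterBottom_ge_switched lam A B p σ hx hF hA h0 hhigh hlow l
  rw [Finset.sum_add_distrib, ← Finset.mul_sum, ← Finset.mul_sum, ← Finset.sum_mul] at hbottom
  have hG : ∑ l, (if B l < 0 then (-(B l * x ^ (lam l))) * rowUK lam A B x * (((σ : ℝ) - ((lam l : ℕ) : ℝ)) ^ 2 * ((p : ℝ) ^ 2 - ((σ : ℝ) - ((lam l : ℕ) : ℝ)) ^ 2)) else 0)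
      = A * rowUK lam A B x * ∑ l, (if B l < 0 then (-(B l * x ^ (lam l))) * rowUK lam A B x * (((σ : ℝ) - ((lam l : ℕ) : ℝ)) ^ 2 * ((p : ℝ) ^ 2 - ((σ : ℝ) - ((lam l : ℕ) : ℝ)) ^ 2)) else 0) + (∑ l, (-(B l * x ^ (lam l))) * rowUK lam A B x) * ∑ l, (if B l < 0 then (-(B l * x ^ (lam l))) * rowUK lam A B x * (((σ : ℝ) - ((lam l : ℕ) : ℝ)) ^ 2 * ((p : ℝ) ^ 2 - ((σ : ℝ) - ((lam l : ℕ) : ℝ)) ^ 2)) else 0) := by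
    rw [← add_mul, h1, one_mul]
  linarith

/-- ★ **THE SWITCHED MASTER LAW for every K** (row switched: `A − Σ B_l x^{λ_l} < 0`; top cluster `B_l > 0` with rates in `[σ, σ+p]`; the other letters —
`B_l < 0` at rates `≤ σ − p`, and the bottom letter needing `σ ≥ p` when `A ≠ 0` — anywhere below): `p²ψ₁ + 6ψ₁² ≤ ψ₃`. [this file's theorem] -/
theorem rowPsiK3_master_law_switched (p σ : ℕ) {x : ℝ} (hx : 0 < x) (hF : A - ∑ l, B l * x ^ (lam l) < 0) (hA : 0 ≤ A) (h0 : A ≠ 0 → p ≤ σ)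
    (hhigh : ∀ l, 0 < B l → σ ≤ lam l ∧ lam l ≤ σ + p) (hlow : ∀ l, B l < 0 → lam l + p ≤ σ) :
    (p : ℝ) ^ 2 * rowPsiK1 lam A B x + 6 * rowPsiK1 lam A B x ^ 2 ≤ rowPsiK3 lam A B x := by
  have h := rowPsiK3_master_ge_switched lam A B p σ hx hF hA h0 hhigh hlow
  have hb := masterBottom_self_nonneg_switched lam A B p σ hF hA h0
  have hu := rowUK_lt_zero lam A B hF
  have hp0 : (0 : ℝ) ≤ (p : ℝ) := Nat.cast_nonneg p
  have hG : 0 ≤ ∑ l, (if B l < 0 then (-(B l * x ^ (lam l))) * rowUK lam A B x * (((σ : ℝ) - ((lam l : ℕ) : ℝ)) ^ 2 * ((p : ℝ) ^ 2 - ((σ : ℝ) - ((lam l : ℕ) : ℝ)) ^ 2)) else 0) := by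
    refine Finset.sum_nonneg fun l _ => ?_
    split_ifs with hl
    · have ha : ((lam l : ℕ) : ℝ) + p ≤ (σ : ℝ) := by exact_mod_cast hlow l hl
      have hw : (-(B l * x ^ (lam l))) * rowUK lam A B x ≤ 0 := by
        have : 0 < -(B l * x ^ (lam l)) := by have := mul_neg_of_neg_of_pos hl (pow_pos hx (lam l)); linarith
        exact mul_nonpos_of_nonneg_of_nonpos this.le hu.le
      exact mul_nonneg_of_nonpos_of_nonpos hw (mul_nonpos_of_nonneg_of_nonpos (sq_nonneg _) (by nlinarith))
    · exact le_rfl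
  linarith

/-- ★ (switched master law, strict from `ψ₁ ≠ 0`). [this file's theorem] -/
theorem rowPsiK3_gt_of_master_switched (p σ : ℕ) {x : ℝ} (hx : 0 < x) (hF : A - ∑ l, B l * x ^ (lam l) < 0) (hA : 0 ≤ A)
    (h0 : A ≠ 0 → p ≤ σ) (hhigh : ∀ l, 0 < B l → σ ≤ lam l ∧ lam l ≤ σ + p) (hlow : ∀ l, B l < 0 → lam l + p ≤ σ)
    (hψ : rowPsiK1 lam A B x ≠ 0) :
    (p : ℝ) ^ 2 * rowPsiK1 lam A B x < rowPsiK3 lam A B x := by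
  have h := rowPsiK3_master_law_switched lam A B p σ hx hF hA h0 hhigh hlow
  have : 0 < rowPsiK1 lam A B x ^ 2 := by positivity
  linarith

/-- ★ (switched master law, strict from a FAR low letter) if some tail letter with `B_l < 0` has `λ_l + p < σ`, then `p²ψ₁ < ψ₃`. [this file's theorem] -/
theorem rowPsiK3_gt_of_master_switched_far (p σ : ℕ) {x : ℝ} (hx : 0 < x) (hF : A - ∑ l, B l * x ^ (lam l) < 0) (hA : 0 ≤ A)
    (h0 : A ≠ 0 → p ≤ σ) (hhigh : ∀ l, 0 < B l → σ ≤ lam l ∧ lam l ≤ σ + p) (hlow : ∀ l, B l < 0 → lam l + p ≤ σ)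
    (hfar : ∃ l, B l < 0 ∧ lam l + p < σ) :
    (p : ℝ) ^ 2 * rowPsiK1 lam A B x < rowPsiK3 lam A B x := by
  have h := rowPsiK3_master_ge_switched lam A B p σ hx hF hA h0 hhigh hlow
  have hb := masterBottom_self_nonneg_switched lam A B p σ hF hA h0
  have hu := rowUK_lt_zero lam A B hF
  have hp0 : (0 : ℝ) ≤ (p : ℝ) := Nat.cast_nonneg p
  have hterm : ∀ l, 0 ≤ (if B l < 0 then (-(B l * x ^ (lam l))) * rowUK lam A B x * (((σ : ℝ) - ((lam l : ℕ) : ℝ)) ^ 2 * ((p : ℝ) ^ 2 - ((σ : ℝ) - ((lam l : ℕ) : ℝ)) ^ 2)) else 0) := by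
    intro l
    split_ifs with hl
    · have ha : ((lam l : ℕ) : ℝ) + p ≤ (σ : ℝ) := by exact_mod_cast hlow l hl
      have hw : (-(B l * x ^ (lam l))) * rowUK lam A B x ≤ 0 := by
        have : 0 < -(B l * x ^ (lam l)) := by have := mul_neg_of_neg_of_pos hl (pow_pos hx (lam l)); linarith
        exact mul_nonpos_of_nonneg_of_nonpos this.le hu.le
      exact mul_nonneg_of_nonpos_of_nonpos hw (mul_nonpos_of_nonneg_of_nonpos (sq_nonneg _) (by nlinarith))
    · exact le_rfl
  obtain ⟨l₀, hl₀, hfar₀⟩ := hfar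
  have hpos : 0 < (if B l₀ < 0 then (-(B l₀ * x ^ (lam l₀))) * rowUK lam A B x * (((σ : ℝ) - ((lam l₀ : ℕ) : ℝ)) ^ 2 * ((p : ℝ) ^ 2 - ((σ : ℝ) - ((lam l₀ : ℕ) : ℝ)) ^ 2)) else 0) := by
    rw [if_pos hl₀]
    have hb : ((lam l₀ : ℕ) : ℝ) + p < (σ : ℝ) := by exact_mod_cast hfar₀
    have hl0 : (0 : ℝ) ≤ ((lam l₀ : ℕ) : ℝ) := Nat.cast_nonneg _
    have hw : (-(B l₀ * x ^ (lam l₀))) * rowUK lam A B x < 0 := by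
      have : 0 < -(B l₀ * x ^ (lam l₀)) := by have := mul_neg_of_neg_of_pos hl₀ (pow_pos hx (lam l₀)); linarith
      exact mul_neg_of_pos_of_neg this hu
    have hsq : 0 < ((σ : ℝ) - ((lam l₀ : ℕ) : ℝ)) ^ 2 := by
      have : (σ : ℝ) - ((lam l₀ : ℕ) : ℝ) ≠ 0 := by linarith
      positivity
    exact mul_pos_of_neg_of_neg hw (mul_neg_of_pos_of_neg hsq (by nlinarith))
  have hge : (if B l₀ < 0 then (-(B l₀ * x ^ (lam l₀))) * rowUK lam A B x * (((σ : ℝ) - ((lam l₀ : ℕ) : ℝ)) ^ 2 * ((p : ℝ) ^ 2 - ((σ : ℝ) - ((lam l₀ : ℕ) : ℝ)) ^ 2)) else 0) ≤ ∑ l, (if B l < 0 then (-(B l * x ^ (lam l))) * rowUK lam A B x * (((σ : ℝ) - ((lam l : ℕ) : ℝ)) ^ 2 * ((p : ℝ) ^ 2 - ((σ : ℝ) - ((lam l : ℕ) : ℝ)) ^ 2)) else 0) := Finset.single_le_sum (fun l _ => hterm l) (Finset.mem_univ l₀)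
  have hsq : 0 ≤ rowPsiK1 lam A B x ^ 2 := sq_nonneg _
  linarith

/-- ★ (switched master law, strict from a FAR bottom letter) if `A ≠ 0` and `p < σ`, then `p²ψ₁ < ψ₃`. [this file's theorem] -/
theorem rowPsiK3_gt_of_master_switched_far0 (p σ : ℕ) {x : ℝ} (hx : 0 < x) (hF : A - ∑ l, B l * x ^ (lam l) < 0) (hA : 0 ≤ A)
    (h0 : A ≠ 0 → p ≤ σ) (hhigh : ∀ l, 0 < B l → σ ≤ lam l ∧ lam l ≤ σ + p) (hlow : ∀ l, B l < 0 → lam l + p ≤ σ)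
    (hA0 : A ≠ 0) (hfar : p < σ) :
    (p : ℝ) ^ 2 * rowPsiK1 lam A B x < rowPsiK3 lam A B x := by
  have h := rowPsiK3_master_ge_switched lam A B p σ hx hF hA h0 hhigh hlow
  have hu := rowUK_lt_zero lam A B hF
  have hp0 : (0 : ℝ) ≤ (p : ℝ) := Nat.cast_nonneg p
  have h1 : A * rowUK lam A B x + ∑ l, (-(B l * x ^ (lam l))) * rowUK lam A B x = 1 := rateWeights_sum_eq_one lam A B hF.ne
  have hG : 0 ≤ ∑ l, (if B l < 0 then (-(B l * x ^ (lam l))) * rowUK lam A B x * (((σ : ℝ) - ((lam l : ℕ) : ℝ)) ^ 2 * ((p : ℝ) ^ 2 - ((σ : ℝ) - ((lam l : ℕ) : ℝ)) ^ 2)) else 0) := by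
    refine Finset.sum_nonneg fun l _ => ?_
    split_ifs with hl
    · have ha : ((lam l : ℕ) : ℝ) + p ≤ (σ : ℝ) := by exact_mod_cast hlow l hl
      have hw : (-(B l * x ^ (lam l))) * rowUK lam A B x ≤ 0 := by
        have : 0 < -(B l * x ^ (lam l)) := by have := mul_neg_of_neg_of_pos hl (pow_pos hx (lam l)); linarith
        exact mul_nonpos_of_nonneg_of_nonpos this.le hu.le
      exact mul_nonneg_of_nonpos_of_nonpos hw (mul_nonpos_of_nonneg_of_nonpos (sq_nonneg _) (by nlinarith))
    · exact le_rfl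
  -- the bottom term is strictly positive
  have hApos : 0 < A := lt_of_le_of_ne hA (Ne.symm hA0)
  have hAu : A * rowUK lam A B x < 0 := mul_neg_of_pos_of_neg hApos hu
  have hσ : (p : ℝ) < (σ : ℝ) := by exact_mod_cast hfar
  have hσ0 : (0 : ℝ) < (σ : ℝ) := lt_of_le_of_lt hp0 hσ
  have hφ : ((σ : ℝ)) ^ 2 * ((p : ℝ) ^ 2 - ((σ : ℝ)) ^ 2) < 0 := mul_neg_of_pos_of_neg (by positivity) (by nlinarith)
  have hT : 0 < ∑ l, (-(B l * x ^ (lam l))) * rowUK lam A B x := by linarith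
  have hb : 0 < (∑ l, (-(B l * x ^ (lam l))) * rowUK lam A B x) * (A * rowUK lam A B x * (((σ : ℝ)) ^ 2 * ((p : ℝ) ^ 2 - ((σ : ℝ)) ^ 2))) := mul_pos hT (mul_pos_of_neg_of_neg hAu hφ)
  have hsq : 0 ≤ rowPsiK1 lam A B x ^ 2 := sq_nonneg _
  linarith

end ProductPlusOne

end Summit.ValiantsHypothesis.ValiantsHypothesis.Theorems.LacunarySymmetroidMatrixDescartes
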